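import Summits.MatrixMultiplication.OmegaCensus.STPP222NeverBeats
import Summits.MatrixMultiplication.OmegaCensus.STPPRepresentationCountNonabelian
import Literature.RepresentationTheory.FiniteGroups.DihedralCharacterDegrees

/-!
# ω-census: CUBES NEVER BEAT THE SUM OF CUBES IN ANY FINITE GROUP — `(2,2,2)^k ⊆ G` forces `8k ≤ Σ_χ d_χ³`

HONEST FRAMING (pub-omega census; verbatim): lottery ticket; floor = certified bounds/negative ranges.
Census STRUCTURE (seat pub-omega-stpp-1 gen 24, 2026-08-27; STRUCTURE.md B3 / N1 / Q1 "is there an inequality for STPP families in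
NON-abelian groups that implies NO_BEATING without search?" — answered here for the pure-cube class).  Nothing here is progress on
`ω`: the theorem says one construction class can never certify `ω < 3`, in any finite group whatsoever.

**`eight_mul_le_charDegreePowSum_three`.**  Let `G` be ANY finite group and `(Aᵢ, Bᵢ, Cᵢ)_{i<k}` a family of triples of 2-subsets
with CKSU's simultaneous triple product property (Def. 5.1 verbatim, the tree's `SimultaneousTPP`).  Then

  `8k = Σᵢ |Aᵢ||Bᵢ||Cᵢ| ≤ Σ_χ d_χ³ = charDegreePowSum G 3`,

so CKSU Thm. 5.5 (`Σᵢ (|Aᵢ||Bᵢ||Cᵢ|)^{ω/3} ≤ Σ_χ d_χ^ω`, tree `CohnKleinbergSzegedyUmans2005_thm55_general`) gives nothing below `ω = 3`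
from such a family.  Proof: if `G` is commutative, `Σ d³ = |G|` (`charDegreePowSum_of_isMulCommutative`) and `8k ≤ |G|` is the
abelian cube theorem `CubeNB.eight_mul_le_card` (Kneser) transported along `Additive G` (`isSTPP_map_ofMul`,
`eight_mul_le_card_of_comm`); if `G` is not commutative, the Kneser-free bound `8k ≤ |G| + 2` (`CubeNB.eight_mul_le_card_add_two`,
`STPPRepresentationCountNonabelian.lean`) combines with `Σ d³ ≥ |G| + 4` (`card_add_four_le_charDegreePowSum_three`: Serre's
Thm. 9 — tree `Serre1977_thm9_holds` — gives a degree `d ≥ 2`, and `Σ d³ − Σ d² = Σ d²(d−1) ≥ 4` with `Σ d² = |G|`, tree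
`sum_sq_charDegrees_holds`); in that case even `8k + 2 ≤ Σ d³` (`eight_mul_add_two_le_charDegreePowSum_three`).

NOT claimed: anything for mixed block sizes; any value of the onset thresholds; anything on `ω`.

References: H. Cohn, R. Kleinberg, B. Szegedy, C. Umans, FOCS 2005 (arXiv:math/0511460), Def. 5.1, Thm. 5.5; J.-P. Serre, *Linear
Representations of Finite Groups*, §2.4 Cor. 2, §3.1 Thm. 9; M. Kneser, Math. Z. 58 (1953).
-/

open Finset

namespace Summit.MatrixMultiplication.OmegaCensus.CubeNB

open Literature.Combinatorics.Additive Literature.RepresentationTheory.FiniteGroups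
  Literature.Computability.AlgebraicComplexity

/-! ## Transfer: CKSU Def 5.1 in a commutative group ⇒ the additive `IsSTPP` of the `Additive` copies -/

/-- In a commutative group, an STPP family (CKSU Def 5.1, `SimultaneousTPP`) yields an `IsSTPP` family of the same block sizes in
the additive copy `Additive H` (one-clause form `simultaneousTPP_iff_forall`, rewritten additively). [cite: CohnKleinbergSzegedyUmans2005, Def. 5.1] -/
theorem isSTPP_map_ofMul {H : Type*} [CommGroup H] {k : ℕ} {A B C : Fin k → Finset H} (h : SimultaneousTPP A B C) :
    IsSTPP (fun i => (A i).map Additive.ofMul.toEmbedding) (fun i => (B i).map Additive.ofMul.toEmbedding)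
      (fun i => (C i).map Additive.ofMul.toEmbedding) := by
  have hP := (simultaneousTPP_iff_forall A B C).1 h
  intro i j l s hs s' hs' t ht t' ht' u hu u' hu' h0
  simp only [mem_map_equiv] at hs hs' ht ht' hu hu'
  have h1 : Additive.ofMul.symm s' / Additive.ofMul.symm s * (Additive.ofMul.symm t' / Additive.ofMul.symm t) *
      (Additive.ofMul.symm u' / Additive.ofMul.symm u) = 1 := by
    apply Additive.ofMul.injective
    simpa using h0
  obtain ⟨hij, hjl, e1, e2, e3⟩ := hP i j l _ hs _ hs' _ ht _ ht' _ hu _ hu' h1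
  exact ⟨hij, hjl, Additive.ofMul.symm.injective e1, Additive.ofMul.symm.injective e2, Additive.ofMul.symm.injective e3⟩

/-- **`8k ≤ |G|` for commutative hosts** (transfer of `CubeNB.eight_mul_le_card` to CKSU Def 5.1 stated multiplicatively in a `Group`
whose multiplication happens to be commutative). [cite: CohnKleinbergSzegedyUmans2005, Def. 5.1] -/
theorem eight_mul_le_card_of_comm {G : Type*} [Group G] [Fintype G] (hcomm : ∀ a b : G, a * b = b * a)
    {k : ℕ} {A B C : Fin k → Finset G} (h : SimultaneousTPP A B C)
    (hc : ∀ i, #(A i) = 2 ∧ #(B i) = 2 ∧ #(C i) = 2) : 8 * k ≤ Fintype.card G := by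
  classical
  letI : CommGroup G := { ‹Group G› with mul_comm := hcomm }
  have hS := isSTPP_map_ofMul (H := G) h
  have hc' : ∀ i, #((A i).map Additive.ofMul.toEmbedding) = 2 ∧ #((B i).map Additive.ofMul.toEmbedding) = 2 ∧
      #((C i).map Additive.ofMul.toEmbedding) = 2 := fun i => by simp only [card_map]; exact hc i
  have := eight_mul_le_card hS hc'
  rwa [← Fintype.card_congr Additive.ofMul] at this

/-! ## Non-abelian groups: `Σ_χ d_χ³ ≥ |G| + 4` -/

/-- For a NON-commutative finite group, `Σ_χ χ(1)³ ≥ |G| + 4`: by Serre's Thm. 9 some irreducible character has degree `d ≥ 2`,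
and `Σ d³ − Σ d² = Σ d²(d − 1) ≥ 4` with `Σ d² = |G|`. [cite: Serre1977, §3.1 Thm. 9] -/
theorem card_add_four_le_charDegreePowSum_three {G : Type} [Group G] [Finite G] (hG : ¬ ∀ a b : G, a * b = b * a) :
    (Nat.card G : ℝ) + 4 ≤ charDegreePowSum G 3 := by
  classical
  have hfin := irrChars_finite_holds G
  have hdeg : ∀ ψ ∈ hfin.toFinset, ∃ e : ℕ, e ∈ charDegrees G ∧ ψ 1 = e := fun ψ hψ => by
    obtain ⟨e, he, h⟩ := IsIrrChar.exists_apply_one (hfin.mem_toFinset.mp hψ)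
    exact ⟨e, he, h⟩
  choose! deg hdegmem hdeg using hdeg
  have hsq : ∑ ψ ∈ hfin.toFinset, deg ψ ^ 2 = Nat.card G := by
    have h := sum_sq_charDegrees_holds G
    rw [finsum_mem_eq_finite_toFinset_sum _ hfin] at h
    have h' : ((∑ ψ ∈ hfin.toFinset, deg ψ ^ 2 : ℕ) : ℂ) = (Nat.card G : ℂ) := by
      rw [← h, Nat.cast_sum]
      exact Finset.sum_congr rfl fun ψ hψ => by rw [Nat.cast_pow, hdeg ψ hψ]
    exact_mod_cast h'
  have hpow : charDegreePowSum G 3 = ((∑ ψ ∈ hfin.toFinset, deg ψ ^ 3 : ℕ) : ℝ) := by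
    unfold charDegreePowSum
    rw [finsum_mem_eq_finite_toFinset_sum _ hfin, Nat.cast_sum]
    refine Finset.sum_congr rfl fun ψ hψ => ?_
    rw [hdeg ψ hψ, Complex.natCast_re, Nat.cast_pow, show (3 : ℝ) = ((3 : ℕ) : ℝ) by norm_num, Real.rpow_natCast]
  -- a degree `≥ 2`
  obtain ⟨d, hd, hd1⟩ : ∃ d ∈ charDegrees G, d ≠ 1 := by
    by_contra hcon
    exact hG ((Serre1977_thm9_holds G).2 fun d hd => by by_contra h1; exact hcon ⟨d, hd, h1⟩)
  have hd2 : 2 ≤ d := by have := pos_of_mem_charDegrees hd; omega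
  obtain ⟨χ₀, hχ₀, hχ₀d⟩ := exists_isIrrChar_of_mem_charDegrees hd
  have hχ₀S : χ₀ ∈ hfin.toFinset := hfin.mem_toFinset.mpr hχ₀
  have hdχ : deg χ₀ = d := by
    have := hdeg χ₀ hχ₀S; rw [hχ₀d] at this; exact_mod_cast this.symm
  -- Σ deg³ ≥ Σ deg² + 4
  have hterm : ∀ ψ ∈ hfin.toFinset, deg ψ ^ 2 ≤ deg ψ ^ 3 := fun ψ hψ => by
    have := pos_of_mem_charDegrees (hdegmem ψ hψ)
    exact Nat.pow_le_pow_right this (by norm_num)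
  have h0 : deg χ₀ ^ 2 + 4 ≤ deg χ₀ ^ 3 := by
    rw [hdχ]
    have : d ^ 3 = d * d ^ 2 := by ring
    rw [this]; nlinarith
  have hsum : ∑ ψ ∈ hfin.toFinset, deg ψ ^ 2 + 4 ≤ ∑ ψ ∈ hfin.toFinset, deg ψ ^ 3 := by
    rw [← sum_erase_add _ _ hχ₀S, ← sum_erase_add _ (fun ψ => deg ψ ^ 3) hχ₀S]
    have := sum_le_sum fun ψ (hψ : ψ ∈ hfin.toFinset.erase χ₀) => hterm ψ (mem_of_mem_erase hψ)
    omega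
  rw [hpow, ← hsq]
  exact_mod_cast hsum

/-! ## Cubes never beat the sum of cubes — in any finite group -/

/-- **CUBES NEVER BEAT THE SUM OF CUBES IN ANY FINITE GROUP.**  If a finite group `G` carries `k` triples of 2-subsets with CKSU's
simultaneous triple product property (Def 5.1 verbatim, `SimultaneousTPP`), then `8k ≤ Σ_χ d_χ³ = charDegreePowSum G 3` — so
CKSU Thm 5.5 (`Σᵢ (|Aᵢ||Bᵢ||Cᵢ|)^{ω/3} ≤ Σ_χ d_χ^ω`) yields no bound `ω < 3` from such a family.  Abelian `G`: `8k ≤ |G| = Σ d³`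
(`CubeNB.eight_mul_le_card`, Kneser); non-abelian `G`: `8k ≤ |G| + 2` (`CubeNB.eight_mul_le_card_add_two`, Kneser-free) and
`Σ d³ ≥ |G| + 4`. [cite: CohnKleinbergSzegedyUmans2005, Def. 5.1 and Thm. 5.5] -/
theorem eight_mul_le_charDegreePowSum_three {G : Type} [Group G] [Fintype G] [DecidableEq G] {k : ℕ}
    {A B C : Fin k → Finset G} (h : SimultaneousTPP A B C) (hc : ∀ i, #(A i) = 2 ∧ #(B i) = 2 ∧ #(C i) = 2) :
    (8 * k : ℝ) ≤ charDegreePowSum G 3 := by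
  by_cases hcomm : ∀ a b : G, a * b = b * a
  · haveI : IsMulCommutative G := ⟨⟨hcomm⟩⟩
    rw [charDegreePowSum_of_isMulCommutative, Nat.card_eq_fintype_card]
    exact_mod_cast eight_mul_le_card_of_comm hcomm h hc
  · have h1 := eight_mul_le_card_add_two h hc
    have h2 := card_add_four_le_charDegreePowSum_three hcomm
    rw [Nat.card_eq_fintype_card] at h2
    have h1' : ((8 * k : ℕ) : ℝ) ≤ ((Fintype.card G + 2 : ℕ) : ℝ) := by exact_mod_cast h1
    push_cast at h1'
    linarith

/-- The same with the strict margin in the non-abelian case recorded: `8k + 2 ≤ Σ_χ d_χ³` unless `G` is commutative. [folklore] -/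
theorem eight_mul_add_two_le_charDegreePowSum_three {G : Type} [Group G] [Fintype G] [DecidableEq G]
    (hG : ¬ ∀ a b : G, a * b = b * a) {k : ℕ} {A B C : Fin k → Finset G} (h : SimultaneousTPP A B C)
    (hc : ∀ i, #(A i) = 2 ∧ #(B i) = 2 ∧ #(C i) = 2) : (8 * k : ℝ) + 2 ≤ charDegreePowSum G 3 := by
  have h1 := eight_mul_le_card_add_two h hc
  have h2 := card_add_four_le_charDegreePowSum_three hG
  rw [Nat.card_eq_fintype_card] at h2
  have h1' : ((8 * k : ℕ) : ℝ) ≤ ((Fintype.card G + 2 : ℕ) : ℝ) := by exact_mod_cast h1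
  push_cast at h1'
  linarith

end Summit.MatrixMultiplication.OmegaCensus.CubeNB
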